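import Mathlib.RingTheory.DedekindDomain.Different
import Mathlib.Topology.Algebra.Group.Quotient
import Literature.NumberTheory.Automorphic.HarrisLanTaylorThorneCor627
import Literature.NumberTheory.GaloisRepresentations.TwistedSumDecomposition
import Literature.NumberTheory.GaloisRepresentations.FrobeniusDensity
import Literature.NumberTheory.GaloisRepresentations.CyclotomicCharacterFrobeniusProofs
import HarnessLib

/-!
# Harris–Lan–Taylor–Thorne 2016, Thm. 7.13 — the proof: realisation of `Γ_{F,S}`, `μ`, `𝔉` and Cor. 7.3

Topic `Literature/NumberTheory/Automorphic` (vocabulary of `ReciprocityGLn`,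
`ReciprocityGLnProofs`, `HarrisLanTaylorThorneCor627`: `CuspidalAutomorphicRepData`,
`IsRegularAlgebraic`, `HasSatakeParamAt`, `IsUnramifiedAbove`, `arithFrobPolyOfSatake`,
`IsGaloisCompatibleAt`, `HasSplitImaginaryQuadraticSubfield`; and of the Galois-representation
files: `FramedGaloisRep`, `FramedRep.charpoly`, `IsUnramifiedAt`, `HasFrobCharpolyAt`,
`primesAbove`, `IsArithFrobAt`, `GaloisRep.cyclotomicCharacter`).

M. Harris, K.-W. Lan, R. Taylor, J. Thorne, *On the rigid cohomology of certain Shimura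
varieties*, Res. Math. Sci. 3:37 (2016), Thm. 7.13 (p. 232), in the standing notation of the
paper (p. 11: `F = F₀F⁺` a CM field containing an imaginary quadratic field `F₀` in which `p`
splits): "Suppose that `π` is a cuspidal automorphic representation of `GL_n(𝔸_F)` such that
`π_∞` has the same infinitesimal character as an algebraic representation of `RS^F_ℚ GL_n`. Then
there is a continuous semi-simple representation `r_{p,ı}(π) : G_F → GL_n(ℚ̄_p)` with the
following property: Suppose that `q ≠ p` is a rational prime which either splits in `F₀` or is
unramified in `F`. Suppose further that `π` is unramified at all primes of `F` above `q`. If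
`v | q` is a prime of `F`, then
`r_{p,ı}(π)|^{F-ss}_{W_{F_v}} = ı⁻¹ rec_{F_v}(π_v |det|_v^{(1-n)/2})`."
Printed proof (p. 232): "We may suppose that `n > 1`, as in the case `n = 1` the result is well
known. Let `S` denote the set of rational primes above which `F` or `π` ramifies together with
`p`; and let `G_{F,S}` denote the Galois group over `F` of the maximal extension of `F`
unramified outside `S`. Apply Proposition 7.12 to `Γ = G_{F,S}`, and `k = ℚ̄_p`, and
`μ = ε_p^{-2}`, and `ℳ` consisting of all sufficiently large integers, and `ρ_m = R_{p,ı}(π, m)`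
(as in Theorem 6.27), and `𝔉` the set of Frobenius elements at primes not above `S`, and
`𝔈¹_{Frob_v}` equal to the multiset of roots of the characteristic polynomial of
`ı⁻¹ rec_{F_v}(π_v |det|_v^{(1-n)/2})(Frob_v)`, and `𝔈²_{Frob_v}` [similarly for `ᶜv`]."

This file and its sibling `HarrisLanTaylorThorneThm713Proofs` PROVE the theorem — in the
tree's vocabulary, for `n > 1`, the conclusion at `v` being `IsGaloisCompatibleAt π ı r v` (`r`
unramified at `v` and every arithmetic Frobenius at `v` has characteristic polynomial
`arithFrobPolyOfSatake ı q_v n α`, the tree's form of `r|^{ss}_{W_{F_v}} = ı⁻¹ rec(π_v|det|^{(1-n)/2})`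
for unramified `π_v`, review 13) — from exactly the following named facts (D-0014), all
hypotheses of the theorem:

* `Literature.NumberTheory.GaloisRepresentations.HarrisLanTaylorThorne2016.prop712Hausdorff` (HLTT Prop. 7.12, the group
  theory, in its corrected form — Hausdorff `k`; the literal `prop712` is refuted, `not_prop712`;
  `GaloisRepresentations/TwistedSumDecomposition`);
* `Literature.NumberTheory.Automorphic.HarrisLanTaylorThorne2016.corollary627_splitOrUnramified` (HLTT Cor. 6.27 at the
  places over a rational prime `q ≠ p` which either splits in `F₀` or is unramified in `F` — the
  rigid-cohomology construction of the `2n`-dimensional `R_{p,ı}(π, N)`;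
  `Automorphic/HarrisLanTaylorThorneCor627`);
* `Literature.NumberTheory.Automorphic.chebotarev_artinRep` (Chebotarev; it enters through the PROVED density of
  Frobenius elements `Literature.NumberTheory.GaloisRepresentations.absoluteGaloisGroup.frobenius_dense`,
  `GaloisRepresentations/FrobeniusDensity`);
* `Literature.NumberTheory.Automorphic.hasSatakeParamAt_ne_zero` (Satake parameters of automorphic representations are
  non-zero; `Automorphic/ReciprocityGLn`), so that the multisets `𝔈¹` avoid `0`;

together with Flath's "`π` is unramified almost everywhere" in the form of the hypothesis
`π.hasSatakeParamAt_cofinite` (named fact of `Automorphic/AutomorphicRepsGL`, Flath 1979,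
Thm. 3), which makes `S` finite.  Division of labour: this file builds the realisation of the
printed proof described below (the group `Γ_{K,S}` with descent and inflation of framed
representations, the character `μ`, the density of the Frobenii in `Γ_{K,S}`, the uniqueness of
twisted-sum decompositions, the finiteness of the set of bad places); the sibling file runs the
printed argument on these (`theorem713_of_goodPlaces`, with the finite set of bad places a
parameter) and deduces Thm. 7.13 with both printed alternatives on `q`
(`Literature.NumberTheory.Automorphic.HarrisLanTaylorThorne2016.theorem713_of`) and its specialisation to the branch
"`q` unramified in `F`" (`theorem713_unramified_of_splitOrUnramified`).  (Until 2026-08-15 this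
file also closed with its own copy of the argument for that branch, `theorem713_unramified_of`,
deduced from the unramified-only form of Cor. 6.27; it was retired as a duplicate of
`theorem713_unramified_of_splitOrUnramified`, whose statement is identical.)

The proof follows the printed one, with the following realisations.
* `Γ_{F,S}` is modelled by `Literature.GammaS K S := Γ_K ⧸ Literature.inertiaOutside K S`, the quotient of
  the absolute Galois group by the normal subgroup *generated* (abstractly, Mathlib
  `Subgroup.normalClosure`; no topological closure is taken) by the inertia groups `I_𝔓`,
  `𝔓 ∣ v`, `v ∉ S`, with its quotient topology (Mathlib `QuotientGroup`, a topological group;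
  the printed `G_{F,S} = Gal(F_S/F)` is its maximal Hausdorff quotient `Γ_K ⧸ closure(…)`, and
  continuous representations with Hausdorff targets factor through either quotient iff they are
  unramified outside `S`, so nothing is lost); a framed Galois representation unramified outside
  `S` descends to it (`FramedGaloisRep.descend`) and representations of it inflate to
  representations of `Γ_K` unramified outside `S` (`FramedRep.inflate`,
  `inflate_isUnramifiedAt`), semisimplicity being preserved and reflected
  (`FramedRep.isSemisimple_inflate_iff`, via the lattice isomorphism of subrepresentations along
  a surjection, `Representation.isSemisimpleRepresentation_comp_iff`).
  The finite set `S` of *bad places* of `K` is a parameter of the sibling's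
  `theorem713_of_goodPlaces`; `finite_setOf_not_exists_goodPrime` proves the finiteness of the
  set used for the branch "`q` unramified in `F`" — the places over `p`, over a rational prime
  ramified in `K`, or over a rational prime below a ramified place of `π` — from which the
  sibling derives the variants it needs (`finite_setOf_not_exists_goodPrime_of_imp`).
* `μ = ε_p^{-2}` is `Literature.muS p S : Γ_{K,S} →ₜ* ℚ̄_pˣ` (descent of the tree's
  `FramedGaloisRep.cyclotomic`, unramified away from `p` by `isUnramifiedAt_cyclotomic_holds`);
  on an arithmetic Frobenius at `v ∉ S` it takes the value `q_v^{-2}` (`coe_muS_mk` and the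
  proved `GaloisRep.cyclotomicCharacter_apply_of_isArithFrobAt`, Serre I-1.2), of infinite order.
* `𝔉` = the image in `Γ_{K,S}` of the arithmetic Frobenius elements at places outside `S`, dense
  by `frobenius_dense` (`GammaS.dense_frob`); `ℳ = [N₀, ∞)`; `ρ_m` = the descent of `R_m`.
* `𝔈¹_f`, `𝔈²_f` are defined by *choosing* a Frobenius `σ ↦ f` at some `v ∉ S` and a Satake
  parameter `α` of `π_v`: `𝔈¹_f` = roots of `arithFrobPolyOfSatake ı q_v n α`, `𝔈²_f = B_v` (the
  multiset provided by Cor. 6.27).  That the outcome at *every* Frobenius `σ'` at *every* good `v`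
  is the predicted polynomial then rests on the uniqueness half of HLTT's Cor. 7.3 (p. 227–228,
  PROVED here as `Literature.NumberTheory.Automorphic.twistedSum_unique`: if `μ(f)` has infinite order, `ℳ` is infinite and
  `Σ¹ ⊔ Σ² μ(f)^m = Σ¹' ⊔ Σ²' μ(f)^m` for all `m ∈ ℳ` with `0 ∉ Σ², Σ²'`, then `Σ¹ = Σ¹'` and
  `Σ² = Σ²'` — "choose `m ∈ ℳ` with `μ(g)^m ≠ α/β` for any `α, β`"), applied to the two
  descriptions of the roots of `charpoly(R_m(σ'))`, and on "monic of degree `n`, split, same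
  roots ⟹ equal" over the algebraically closed `ℚ̄_p`.
The case `n = 1` ("well known": class field theory) and the passage from Thm. 7.13 to Thm. A /
Cor. 7.14 (arbitrary CM or totally real `E`, no condition on `q` in `E`: Sorensen's patching
lemma, base change) are not addressed here; see `ReciprocityGLnProofs` (lower layer 2).

## References

* M. Harris, K.-W. Lan, R. Taylor, J. Thorne, *On the rigid cohomology of certain Shimura
  varieties*, Res. Math. Sci. 3:37 (2016): p. 11 (notation), §7 p. 225 (setting), Cor. 7.3
  (pp. 227–228), Prop. 7.12, Thm. 7.13 and its proof, Cor. 7.14 (p. 232).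
  [HarrisLanTaylorThorneRMS2016]
* J.-P. Serre, *Abelian ℓ-adic representations and elliptic curves* (1968), Ch. I §1.2 (the
  cyclotomic character), §2.1–2.3. [SerreAbelianLadic1968]
* D. Flath, *Decomposition of representations into tensor products*, Corvallis (1979), Thm. 3.
  [Flath1979]
-/

noncomputable section

open scoped MatrixGroups Matrix Classical Polynomial NumberField
open NumberField IsDedekindDomain Field Polynomial Literature.NumberTheory.Automorphic

namespace Literature.NumberTheory.Automorphic

/-! ### Semisimplicity is invariant under inflation along a surjection -/

section Inflation

variable {k G H V : Type*} [Field k] [Group G] [Group H] [AddCommGroup V] [Module k V]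

/-- For a surjective homomorphism `f : G → H` and a representation `ρ` of `H`, the
subrepresentations of `ρ ∘ f` and of `ρ` are the same submodules, so `ρ ∘ f` is semisimple
(every subrepresentation has a complement, Mathlib `Representation.IsSemisimpleRepresentation`)
iff `ρ` is (Mathlib `OrderIso.complementedLattice_iff`). [folklore] -/
theorem Representation.isSemisimpleRepresentation_comp_iff (ρ : Representation k H V)
    (f : G →* H) (hf : Function.Surjective f) :
    (Representation.IsSemisimpleRepresentation (ρ.comp f)) ↔ ρ.IsSemisimpleRepresentation :=
  OrderIso.complementedLattice_iff
    { toFun := fun W ↦ ⟨W.toSubmodule, fun h v hv ↦ by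
        obtain ⟨g, rfl⟩ := hf h
        exact W.apply_mem_toSubmodule g hv⟩
      invFun := fun W ↦ ⟨W.toSubmodule, fun g v hv ↦ W.apply_mem_toSubmodule (f g) hv⟩
      left_inv := fun _ ↦ rfl
      right_inv := fun _ ↦ rfl
      map_rel_iff' := Iff.rfl }

end Inflation

/-! ### The quotient `Γ_{K,S}` of `Γ_K` by the inertia outside `S` -/

section GammaS

variable (K : Type) [Field K] (S : Set (HeightOneSpectrum (𝓞 K)))

/-- The normal subgroup of `Γ_K` generated by the inertia groups `I_𝔓` (Mathlib `Ideal.inertia`)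
at all primes `𝔓` of `\bar ℤ_K` above the finite places outside `S` (Mathlib
`Subgroup.normalClosure`, the abstract normal closure — its topological closure is the kernel
of `Γ_K → G_{K,S} = Gal(K_S/K)`, `K_S` the maximal extension of `K` unramified outside `S`).
Serre, *Abelian `ℓ`-adic representations*, I-2.1. [folklore] -/
def inertiaOutside : Subgroup (absoluteGaloisGroup K) :=
  Subgroup.normalClosure
    (⋃ v ∈ Sᶜ, ⋃ 𝔓 ∈ (v : HeightOneSpectrum (𝓞 K)).primesAbove,
      ((𝔓.inertia (absoluteGaloisGroup K) : Subgroup (absoluteGaloisGroup K)) :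
        Set (absoluteGaloisGroup K)))

/-- `inertiaOutside K S` is normal (Mathlib `Subgroup.normalClosure_normal`). [folklore] -/
instance inertiaOutside_normal : (inertiaOutside K S).Normal :=
  Subgroup.normalClosure_normal

/-- **`Γ_{K,S}`**, a model of "`G_{F,S}`, the Galois group over `F` of the maximal extension of `F`
unramified outside `S`" (HLTT p. 232): the topological quotient group
`Γ_K ⧸ inertiaOutside K S` by the (abstract) normal subgroup generated by the inertia groups
outside `S` (so `G_{K,S}` itself is the maximal Hausdorff quotient of `GammaS K S`; a continuous
representation of `Γ_K` is unramified outside `S` iff it factors through `GammaS K S`,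
`FramedGaloisRep.descend` / `FramedRep.inflate_isUnramifiedAt`, and representations with
Hausdorff targets then factor further through `G_{K,S}`).
[cite: HarrisLanTaylorThorneRMS2016, proof of Thm. 7.13 (p. 232)] -/
abbrev GammaS : Type := absoluteGaloisGroup K ⧸ inertiaOutside K S

variable {K S}

/-- A framed Galois representation unramified outside `S` kills `inertiaOutside K S`
(Mathlib `Subgroup.normalClosure_le_normal`). [folklore] -/
theorem inertiaOutside_le_ker {A : Type*} [CommRing A] [TopologicalSpace A] {n : ℕ}
    (ρ : GaloisRepresentations.FramedGaloisRep K A n) (hρ : ∀ v ∉ S, ρ.IsUnramifiedAt v) :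
    inertiaOutside K S ≤ (ρ : absoluteGaloisGroup K →* GL (Fin n) A).ker := by
  refine Subgroup.normalClosure_le_normal ?_
  intro σ hσ
  simp only [Set.mem_iUnion, Set.mem_compl_iff, exists_prop, SetLike.mem_coe] at hσ
  obtain ⟨v, hv, 𝔓, h𝔓, hσ⟩ := hσ
  exact hρ v hv 𝔓 h𝔓 σ hσ

/-- **Descent to `Γ_{K,S}`** of a framed Galois representation unramified outside `S`
(Mathlib `QuotientGroup.lift`; continuity from the quotient map being a quotient map,
`QuotientGroup.isQuotientMap_mk`). [folklore] -/
def _root_.Literature.NumberTheory.GaloisRepresentations.FramedGaloisRep.descend {A : Type*} [CommRing A] [TopologicalSpace A] {n : ℕ}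
    (ρ : GaloisRepresentations.FramedGaloisRep K A n) (hρ : ∀ v ∉ S, ρ.IsUnramifiedAt v) :
    GaloisRepresentations.FramedRep (GammaS K S) A n where
  toMonoidHom := QuotientGroup.lift _ (ρ : absoluteGaloisGroup K →* GL (Fin n) A)
    (inertiaOutside_le_ker ρ hρ)
  continuous_toFun := by
    rw [(QuotientGroup.isQuotientMap_mk (inertiaOutside K S)).continuous_iff]
    exact ρ.continuous

/-- Unfolding lemma for `FramedGaloisRep.descend`. [folklore] -/
@[simp] theorem _root_.Literature.NumberTheory.GaloisRepresentations.FramedGaloisRep.descend_mk {A : Type*} [CommRing A] [TopologicalSpace A] {n : ℕ}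
    (ρ : GaloisRepresentations.FramedGaloisRep K A n) (hρ : ∀ v ∉ S, ρ.IsUnramifiedAt v) (σ : absoluteGaloisGroup K) :
    ρ.descend hρ (QuotientGroup.mk σ) = ρ σ := rfl

/-- **Inflation** of a framed representation of `Γ_{K,S}` to `Γ_K` (composition with the
quotient map). [folklore] -/
def _root_.Literature.NumberTheory.GaloisRepresentations.FramedRep.inflate {A : Type*} [CommRing A] [TopologicalSpace A] {n : ℕ}
    (ρ : GaloisRepresentations.FramedRep (GammaS K S) A n) : GaloisRepresentations.FramedGaloisRep K A n :=
  ρ.comp ⟨QuotientGroup.mk' _, continuous_quot_mk⟩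

/-- Unfolding lemma for `FramedRep.inflate`. [folklore] -/
@[simp] theorem _root_.Literature.NumberTheory.GaloisRepresentations.FramedRep.inflate_apply {A : Type*} [CommRing A] [TopologicalSpace A] {n : ℕ}
    (ρ : GaloisRepresentations.FramedRep (GammaS K S) A n) (σ : absoluteGaloisGroup K) :
    ρ.inflate σ = ρ (QuotientGroup.mk σ) := rfl

/-- An inflated representation is unramified outside `S`. [folklore] -/
theorem _root_.Literature.NumberTheory.GaloisRepresentations.FramedRep.inflate_isUnramifiedAt {A : Type*} [CommRing A] [TopologicalSpace A] {n : ℕ}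
    (ρ : GaloisRepresentations.FramedRep (GammaS K S) A n) {v : HeightOneSpectrum (𝓞 K)} (hv : v ∉ S) :
    ρ.inflate.IsUnramifiedAt v := by
  intro 𝔓 h𝔓 σ hσ
  rw [GaloisRepresentations.FramedRep.inflate_apply]
  have : (QuotientGroup.mk σ : GammaS K S) = 1 := by
    rw [QuotientGroup.eq_one_iff]
    refine Subgroup.subset_normalClosure ?_
    simp only [Set.mem_iUnion, Set.mem_compl_iff, exists_prop, SetLike.mem_coe]
    exact ⟨v, hv, 𝔓, h𝔓, hσ⟩
  rw [this, map_one]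

/-- Descending and inflating back gives the original representation. [folklore] -/
theorem _root_.Literature.NumberTheory.GaloisRepresentations.FramedGaloisRep.inflate_descend {A : Type*} [CommRing A] [TopologicalSpace A] {n : ℕ}
    (ρ : GaloisRepresentations.FramedGaloisRep K A n) (hρ : ∀ v ∉ S, ρ.IsUnramifiedAt v) :
    (ρ.descend hρ).inflate = ρ :=
  ContinuousMonoidHom.ext fun _ ↦ rfl

/-- Characteristic polynomials are unchanged by inflation. [folklore] -/
theorem _root_.Literature.NumberTheory.GaloisRepresentations.FramedRep.charpoly_inflate {A : Type*} [CommRing A] [TopologicalSpace A] {n : ℕ}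
    (ρ : GaloisRepresentations.FramedRep (GammaS K S) A n) (σ : absoluteGaloisGroup K) :
    GaloisRepresentations.FramedRep.charpoly ρ.inflate σ = GaloisRepresentations.FramedRep.charpoly ρ (QuotientGroup.mk σ) := rfl

/-- Characteristic polynomials are unchanged by descent. [folklore] -/
theorem _root_.Literature.NumberTheory.GaloisRepresentations.FramedGaloisRep.charpoly_descend_mk {A : Type*} [CommRing A] [TopologicalSpace A]
    {n : ℕ} (ρ : GaloisRepresentations.FramedGaloisRep K A n) (hρ : ∀ v ∉ S, ρ.IsUnramifiedAt v)
    (σ : absoluteGaloisGroup K) :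
    GaloisRepresentations.FramedRep.charpoly (ρ.descend hρ) (QuotientGroup.mk σ) = GaloisRepresentations.FramedRep.charpoly ρ σ := rfl

/-- The representation underlying an inflation is the inflation of the underlying
representation. [folklore] -/
theorem _root_.Literature.NumberTheory.GaloisRepresentations.FramedRep.toRepresentation_inflate {A : Type*} [CommRing A] [TopologicalSpace A] {n : ℕ}
    (ρ : GaloisRepresentations.FramedRep (GammaS K S) A n) :
    ρ.inflate.toRepresentation =
      ρ.toRepresentation.comp (QuotientGroup.mk' (inertiaOutside K S)) := rfl

/-- Inflation from `Γ_{K,S}` to `Γ_K` preserves and reflects semisimplicity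
(`Representation.isSemisimpleRepresentation_comp_iff`). [folklore] -/
theorem _root_.Literature.NumberTheory.GaloisRepresentations.FramedRep.isSemisimple_inflate_iff {k : Type*} [Field k] [TopologicalSpace k]
    [IsTopologicalRing k] {n : ℕ} (ρ : GaloisRepresentations.FramedRep (GammaS K S) k n) :
    ρ.inflate.toContinuousRep.IsSemisimple ↔ ρ.toContinuousRep.IsSemisimple := by
  change Representation.IsSemisimpleRepresentation ρ.inflate.toRepresentation ↔
    Representation.IsSemisimpleRepresentation ρ.toRepresentation
  rw [GaloisRepresentations.FramedRep.toRepresentation_inflate]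
  exact Representation.isSemisimpleRepresentation_comp_iff _ _ (QuotientGroup.mk'_surjective _)

/-- **The Frobenius elements outside `S` are dense in `Γ_{K,S}`**: the image of a dense set
(`absoluteGaloisGroup.frobenius_dense`, from Chebotarev) under the continuous surjection
`Γ_K → Γ_{K,S}`. ("`𝔉` the set of Frobenius elements at primes not above `S`", a dense subset
of `G_{F,S}`, HLTT p. 232.) [cite: HarrisLanTaylorThorneRMS2016, proof of Thm. 7.13 (p. 232)] -/
theorem GammaS.dense_frob [NumberField K] (hC : Automorphic.chebotarev_artinRep) (hS : S.Finite) :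
    Dense ((QuotientGroup.mk : absoluteGaloisGroup K → GammaS K S) ''
      {σ | ∃ v ∉ S, ∃ 𝔓 ∈ v.primesAbove, IsArithFrobAt (𝓞 K) σ 𝔓}) :=
  (QuotientGroup.mk_surjective.denseRange).dense_image QuotientGroup.continuous_mk
    (GaloisRepresentations.absoluteGaloisGroup.frobenius_dense hC K S hS)

end GammaS

/-! ### The character `μ = ε_p^{-2}` of `Γ_{K,S}` -/

section Mu

variable (p : ℕ) [Fact p.Prime] {K : Type} [Field K] [NumberField K]
  (S : Set (HeightOneSpectrum (𝓞 K)))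

/-- **`μ = ε_p^{-2} : Γ_{K,S} → ℚ̄_pˣ`** (HLTT p. 232), for `S` containing the places above `p`:
the `p`-adic cyclotomic character `ε_p : Γ_K → ℤ_pˣ` (the tree's `FramedGaloisRep.cyclotomic`,
unramified at `v ∤ p` by `FramedGaloisRep.isUnramifiedAt_cyclotomic_holds`) descended to
`Γ_{K,S}`, pushed to `ℚ̄_p` along `ℤ_p → ℚ_p → ℚ̄_p`, and raised to the power `-2`.
[cite: HarrisLanTaylorThorneRMS2016, proof of Thm. 7.13 (p. 232)] -/
def muS (hS : ∀ v ∉ S, ((p : ℕ) : 𝓞 K) ∉ v.asIdeal) : GammaS K S →ₜ* (PadicAlgCl p)ˣ where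
  toMonoidHom := (zpowGroupHom (-2)).comp
    ((Units.map ((algebraMap ℚ_[p] (PadicAlgCl p)).comp PadicInt.Coe.ringHom :
        ℤ_[p] →* PadicAlgCl p)).comp
      (GaloisRepresentations.FramedRep.det (((GaloisRepresentations.FramedGaloisRep.cyclotomic K p).descend fun v hv ↦
        GaloisRepresentations.FramedGaloisRep.isUnramifiedAt_cyclotomic_holds K p (hS v hv)))).toMonoidHom)
  continuous_toFun := by
    have hc : Continuous ((algebraMap ℚ_[p] (PadicAlgCl p)).comp PadicInt.Coe.ringHom) :=
      (continuous_algebraMap ℚ_[p] (PadicAlgCl p)).comp continuous_subtype_val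
    refine (continuous_zpow (-2)).comp ?_
    exact (Continuous.units_map _ hc).comp (GaloisRepresentations.FramedRep.det _).continuous

/-- The value of `μ` at (the image of) `σ ∈ Γ_K` is `ε_p(σ)^{-2}`, computed in `ℚ̄_p`
(`FramedGaloisRep.det_cyclotomic_apply`). [folklore] -/
theorem coe_muS_mk (hS : ∀ v ∉ S, ((p : ℕ) : 𝓞 K) ∉ v.asIdeal) (σ : absoluteGaloisGroup K) :
    ((muS p S hS (QuotientGroup.mk σ) : (PadicAlgCl p)ˣ) : PadicAlgCl p) =
      (algebraMap ℚ_[p] (PadicAlgCl p)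
        ((GaloisRepresentations.GaloisRep.cyclotomicCharacter K p σ : ℤ_[p]ˣ) : ℤ_[p])) ^ (-2 : ℤ) := by
  have hdet : GaloisRepresentations.FramedRep.det (((GaloisRepresentations.FramedGaloisRep.cyclotomic K p).descend fun v hv ↦
      GaloisRepresentations.FramedGaloisRep.isUnramifiedAt_cyclotomic_holds K p (hS v hv)) :
        GaloisRepresentations.FramedRep (GammaS K S) ℤ_[p] 1) (QuotientGroup.mk σ) =
      GaloisRepresentations.GaloisRep.cyclotomicCharacter K p σ := by
    rw [← GaloisRepresentations.FramedGaloisRep.det_cyclotomic_apply]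
    rfl
  change ((((Units.map (((algebraMap ℚ_[p] (PadicAlgCl p)).comp PadicInt.Coe.ringHom :
      ℤ_[p] →* PadicAlgCl p))) (GaloisRepresentations.FramedRep.det _ (QuotientGroup.mk σ))) ^ (-2 : ℤ) :
      (PadicAlgCl p)ˣ) : PadicAlgCl p) = _
  rw [hdet, Units.val_zpow_eq_zpow_val, Units.coe_map, MonoidHom.coe_coe]
  rfl

/-- **`μ(Frob_v) = q_v^{-2}`**: at an arithmetic Frobenius `σ` at a prime above `v ∉ S` (so
`v ∤ p`), `μ(σ) = (N v)^{-2}` — the proved `χ_p(Frob_v) = N v`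
(`GaloisRep.cyclotomicCharacter_apply_of_isArithFrobAt`, Serre I-1.2).
[cite: SerreAbelianLadic1968, Ch. I §1.2 (Example: the cyclotomic character)] -/
theorem coe_muS_mk_of_isArithFrobAt (hS : ∀ v ∉ S, ((p : ℕ) : 𝓞 K) ∉ v.asIdeal)
    {σ : absoluteGaloisGroup K} {v : HeightOneSpectrum (𝓞 K)} (hv : v ∉ S)
    {𝔓 : Ideal (GaloisRepresentations.absIntegers (𝓞 K) K)} (h𝔓 : 𝔓 ∈ v.primesAbove)
    (hσ : IsArithFrobAt (𝓞 K) σ 𝔓) :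
    ((muS p S hS (QuotientGroup.mk σ) : (PadicAlgCl p)ˣ) : PadicAlgCl p) =
      ((v.residueCard : PadicAlgCl p) ^ 2)⁻¹ := by
  rw [coe_muS_mk, GaloisRepresentations.GaloisRep.cyclotomicCharacter_apply_of_isArithFrobAt (hS v hv) h𝔓 hσ,
    PadicInt.coe_natCast, map_natCast, zpow_neg, zpow_ofNat]

/-- Integral powers of `μ(Frob_v)`: `μ(Frob_v)^m = (q_v⁻¹)^{2m}` for `m ≥ 0`. [folklore] -/
theorem coe_muS_mk_zpow_of_isArithFrobAt (hS : ∀ v ∉ S, ((p : ℕ) : 𝓞 K) ∉ v.asIdeal)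
    {σ : absoluteGaloisGroup K} {v : HeightOneSpectrum (𝓞 K)} (hv : v ∉ S)
    {𝔓 : Ideal (GaloisRepresentations.absIntegers (𝓞 K) K)} (h𝔓 : 𝔓 ∈ v.primesAbove)
    (hσ : IsArithFrobAt (𝓞 K) σ 𝔓) {m : ℤ} (hm : 0 ≤ m) :
    (((muS p S hS (QuotientGroup.mk σ)) ^ m : (PadicAlgCl p)ˣ) : PadicAlgCl p) =
      ((v.residueCard : PadicAlgCl p)⁻¹) ^ (2 * m.toNat) := by
  rw [Units.val_zpow_eq_zpow_val, coe_muS_mk_of_isArithFrobAt p S hS hv h𝔓 hσ]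
  conv_lhs => rw [show m = ((m.toNat : ℕ) : ℤ) by omega, zpow_natCast]
  rw [pow_mul, ← inv_pow]

/-- **`μ(Frob_v)` has infinite order** (`q_v > 1` and `ℚ̄_p` has characteristic `0`); this is the
hypothesis "`μ(f)` has infinite order for all `f ∈ 𝔉`" of Prop. 7.12. [folklore] -/
theorem not_isOfFinOrder_muS_mk (hS : ∀ v ∉ S, ((p : ℕ) : 𝓞 K) ∉ v.asIdeal)
    {σ : absoluteGaloisGroup K} {v : HeightOneSpectrum (𝓞 K)} (hv : v ∉ S)
    {𝔓 : Ideal (GaloisRepresentations.absIntegers (𝓞 K) K)} (h𝔓 : 𝔓 ∈ v.primesAbove)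
    (hσ : IsArithFrobAt (𝓞 K) σ 𝔓) : ¬ IsOfFinOrder (muS p S hS (QuotientGroup.mk σ)) := by
  intro hfin
  obtain ⟨k, hk, hk1⟩ := hfin.exists_pow_eq_one
  have h := congrArg (fun u : (PadicAlgCl p)ˣ ↦ (u : PadicAlgCl p)) hk1
  simp only [Units.val_pow_eq_pow_val, Units.val_one,
    coe_muS_mk_of_isArithFrobAt p S hS hv h𝔓 hσ] at h
  rw [inv_pow, inv_eq_one, ← pow_mul, ← Nat.cast_pow, Nat.cast_eq_one, pow_eq_one_iff] at h
  rcases h with h | h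
  · exact (ne_of_gt v.one_lt_residueCard) h
  · exact (Nat.mul_ne_zero two_ne_zero hk.ne') h

end Mu

/-! ### Uniqueness of twisted-sum decompositions of multisets (HLTT Cor. 7.3) -/

section TwistedSum

variable {k : Type*} [Field k]

/-- For `t ∈ kˣ` of infinite order and `β ≠ 0`, the equation `β t^m = α` has at most one
solution `m ∈ ℤ` (Mathlib `injective_zpow_iff_not_isOfFinOrder`). [folklore] -/
theorem subsingleton_setOf_mul_zpow_eq {t : kˣ} (ht : ¬ IsOfFinOrder t) (α β : k) (hβ : β ≠ 0) :
    {m : ℤ | β * ((t ^ m : kˣ) : k) = α}.Subsingleton := by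
  intro m hm m' hm'
  simp only [Set.mem_setOf_eq] at hm hm'
  have h : ((t ^ m : kˣ) : k) = ((t ^ m' : kˣ) : k) := by
    apply mul_left_cancel₀ hβ
    rw [hm, hm']
  exact (injective_zpow_iff_not_isOfFinOrder.mpr ht) (Units.val_injective h)

/-- **Harris–Lan–Taylor–Thorne 2016, Cor. 7.3, uniqueness clause** ("Moreover if `μ(g)` has
infinite order then the multisets `Σ¹_g` and `Σ²_g` are unique", p. 227; proof p. 228: "Choose
`m ∈ ℳ` with `μ(g)^m ≠ α/β` for any `α, β ∈ Σ¹_g ⊔ Σ²_g ⊔ Σ¹'_g ⊔ Σ²'_g`. Then the equality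
`Σ¹_g ⊔ Σ²_g μ(g)^m = Σ¹'_g ⊔ Σ²'_g μ(g)^m` implies that `Σ¹'_g = Σ¹_g` and `Σ²'_g = Σ²_g`"), as an
abstract statement about multisets: if `t ∈ kˣ` has infinite order, `ℳ ⊆ ℤ` is infinite,
`0 ∉ S₂, S₂'`, and `S₁ + S₂·t^m = S₁' + S₂'·t^m` for all `m ∈ ℳ`, then `S₁ = S₁'` and
`S₂ = S₂'`.  PROVED (the finitely many bad exponents are avoided inside the infinite `ℳ`).
[cite: HarrisLanTaylorThorneRMS2016, Cor. 7.3 (pp. 227–228)] -/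
theorem twistedSum_unique {t : kˣ} (ht : ¬ IsOfFinOrder t)
    {ℳ : Set ℤ} (hℳ : ℳ.Infinite) {S₁ S₂ S₁' S₂' : Multiset k}
    (h0 : (0 : k) ∉ S₂) (h0' : (0 : k) ∉ S₂')
    (h : ∀ m ∈ ℳ, S₁ + S₂.map (· * ((t ^ m : kˣ) : k)) =
      S₁' + S₂'.map (· * ((t ^ m : kˣ) : k))) :
    S₁ = S₁' ∧ S₂ = S₂' := by
  classical
  -- a good exponent: `β t^m ≠ α` for all `α` occurring anywhere and `β ∈ S₂ ∪ S₂'`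
  set A : Finset k := (S₁ + S₂ + S₁' + S₂').toFinset with hA
  set B : Finset k := (S₂ + S₂').toFinset with hB
  have hbad : (⋃ p ∈ A ×ˢ B, {m : ℤ | p.2 * ((t ^ m : kˣ) : k) = p.1}).Finite := by
    refine Set.Finite.biUnion (Finset.finite_toSet _) fun p hp ↦ ?_
    refine (subsingleton_setOf_mul_zpow_eq ht p.1 p.2 ?_).finite
    have hp2 : p.2 ∈ B := (Finset.mem_product.mp hp).2
    rw [hB, Multiset.mem_toFinset, Multiset.mem_add] at hp2
    rintro h0p
    rcases hp2 with h2 | h2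
    · exact h0 (h0p ▸ h2)
    · exact h0' (h0p ▸ h2)
  obtain ⟨m, hmℳ, hm⟩ := (hℳ.sdiff hbad).nonempty
  simp only [Set.mem_iUnion, Set.mem_setOf_eq, not_exists, exists_prop, not_and] at hm
  have hm' := h m hmℳ
  set u : k := ((t ^ m : kˣ) : k) with hu
  have hu0 : u ≠ 0 := (t ^ m).ne_zero
  have hgood : ∀ α ∈ A, ∀ β ∈ B, β * u ≠ α := fun α hα β hβ ↦
    hm (α, β) (Finset.mem_product.mpr ⟨hα, hβ⟩)
  -- `S₂ u` and `S₂' u` miss `S₁` and `S₁'`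
  have hmiss : ∀ x, (x ∈ S₂.map (· * u) ∨ x ∈ S₂'.map (· * u)) →
      Multiset.count x S₁ = 0 ∧ Multiset.count x S₁' = 0 := by
    intro x hx
    have hxB : ∃ β ∈ B, β * u = x := by
      rcases hx with hx | hx
      · obtain ⟨β, hβ, rfl⟩ := Multiset.mem_map.mp hx
        exact ⟨β, by rw [hB, Multiset.mem_toFinset, Multiset.mem_add]; exact Or.inl hβ, rfl⟩
      · obtain ⟨β, hβ, rfl⟩ := Multiset.mem_map.mp hx
        exact ⟨β, by rw [hB, Multiset.mem_toFinset, Multiset.mem_add]; exact Or.inr hβ, rfl⟩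
    obtain ⟨β, hβ, rfl⟩ := hxB
    constructor
    · rw [Multiset.count_eq_zero]
      intro hx1
      exact hgood _ (by rw [hA, Multiset.mem_toFinset]; simp [hx1]) β hβ rfl
    · rw [Multiset.count_eq_zero]
      intro hx1
      exact hgood _ (by rw [hA, Multiset.mem_toFinset]; simp [hx1]) β hβ rfl
  have h2 : S₂.map (· * u) = S₂'.map (· * u) := by
    ext x
    have hc := congrArg (Multiset.count x) hm'
    simp only [Multiset.count_add] at hc
    by_cases hx : x ∈ S₂.map (· * u) ∨ x ∈ S₂'.map (· * u)
    · obtain ⟨h1, h1'⟩ := hmiss x hx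
      rw [h1, h1'] at hc
      simpa using hc
    · rw [not_or] at hx
      rw [Multiset.count_eq_zero_of_notMem hx.1, Multiset.count_eq_zero_of_notMem hx.2]
  have hS₂ : S₂ = S₂' :=
    Multiset.map_injective (mul_left_injective₀ hu0) h2
  refine ⟨?_, hS₂⟩
  rw [h2] at hm'
  exact add_right_cancel hm'

end TwistedSum

/-! ### Polynomial bookkeeping -/

section Poly

variable {k : Type*} [Field k]

/-- `∏_{a ∈ s} (X - g a) = ∏_{b ∈ g(s)} (X - b)` (Mathlib `Multiset.map_map`). [folklore] -/
theorem multiset_prod_X_sub_C_map {τ : Type*} (s : Multiset τ) (g : τ → k) :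
    (s.map fun a ↦ X - C (g a)).prod = ((s.map g).map fun a ↦ X - C a).prod := by
  rw [Multiset.map_map]; rfl

/-- Over an algebraically closed field a monic polynomial is the product of `X - a` over its
roots (Mathlib `prod_multiset_X_sub_C_of_monic_of_roots_card_eq`,
`IsAlgClosed.card_roots_eq_natDegree`). [folklore] -/
theorem eq_prod_roots_of_monic [IsAlgClosed k] {P : k[X]} (hP : P.Monic) :
    P = (P.roots.map fun a ↦ X - C a).prod :=
  (prod_multiset_X_sub_C_of_monic_of_roots_card_eq hP (IsAlgClosed.card_roots_eq_natDegree)).symm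

end Poly

section Lang
namespace HarrisLanTaylorThorne2016

/-! ### The Frobenius polynomial of a Satake parameter: roots -/

section FrobPoly

variable {p : ℕ} [Fact p.Prime]

/-- The roots of `arithFrobPolyOfSatake ı q m α` avoid `0` when `q > 0` and `α` avoids `0`
(`roots_arithFrobPolyOfSatake`). [folklore] -/
theorem zero_not_mem_roots_arithFrobPolyOfSatake (ι : PadicAlgCl p ≃+* ℂ) {q : ℕ} (hq : 0 < q)
    (m : ℕ) {α : Multiset ℂ} (hα : ∀ a ∈ α, a ≠ 0) :
    (0 : PadicAlgCl p) ∉ (arithFrobPolyOfSatake ι q m α).roots := by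
  rw [roots_arithFrobPolyOfSatake, Multiset.mem_map]
  rintro ⟨a, ha, h0⟩
  rw [map_eq_zero, inv_eq_zero, mul_eq_zero] at h0
  rcases h0 with h0 | h0
  · rw [pow_eq_zero_iff', Complex.ofReal_eq_zero] at h0
    exact (Real.sqrt_pos.mpr (by exact_mod_cast hq)).ne' h0.1
  · exact hα a ha h0

/-- `arithFrobPolyOfSatake ı q m α` has `card α` roots (`roots_arithFrobPolyOfSatake`).
[folklore] -/
theorem card_roots_arithFrobPolyOfSatake (ι : PadicAlgCl p ≃+* ℂ) (q m : ℕ) (α : Multiset ℂ) :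
    Multiset.card (arithFrobPolyOfSatake ι q m α).roots = Multiset.card α := by
  rw [roots_arithFrobPolyOfSatake, Multiset.card_map]

/-- `arithFrobPolyOfSatake ı q m α` is the product of `X - a` over its roots. [folklore] -/
theorem arithFrobPolyOfSatake_eq_prod_roots (ι : PadicAlgCl p ≃+* ℂ) (q m : ℕ) (α : Multiset ℂ) :
    arithFrobPolyOfSatake ι q m α =
      ((arithFrobPolyOfSatake ι q m α).roots.map fun a ↦ X - C a).prod := by
  rw [roots_arithFrobPolyOfSatake]
  unfold arithFrobPolyOfSatake
  exact multiset_prod_X_sub_C_map α (fun a ↦ ι.symm (((Real.sqrt q : ℝ) : ℂ) ^ (m - 1) * a)⁻¹)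

end FrobPoly

/-! ### The bad places are finite -/

section BadPlaces

variable {n : ℕ} {K : Type} [Field K] [NumberField K] {hcpt : isCompact_glFiniteIntegralLevel n K}

/-- **The set `S` of bad places is finite.**  For a prime `p` and an automorphic `π` which is
unramified almost everywhere (hypothesis `hcof`, Flath's theorem as the named fact
`hasSatakeParamAt_cofinite`), all but finitely many finite places `v` of `K` lie over a rational
prime `q ≠ p` which is unramified in `K` (Mathlib `Algebra.IsUnramifiedIn (𝓞 K) (q)`) and above
which `π` is unramified: the exceptions lie over `p`, over one of the finitely many rational
primes ramified in `K` (those below the prime factors of the different `𝔇_{K/ℚ} ≠ 0`, Mathlib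
`not_dvd_differentIdeal_iff`, `differentIdeal_ne_bot`; cf. the tree's relative version
`Literature.NumberTheory.GaloisRepresentations.finite_setOf_not_isUnramifiedIn` in `GaloisRepresentations/FrobeniusDensityTheorem`), or
over a rational prime below one of the finitely many ramified places of `π`; and only finitely
many places lie over a given rational prime (Mathlib `Ideal.finite_factors`).  ("Let `S` denote
the set of rational primes above which `F` or `π` ramifies together with `p`", HLTT p. 232.)
[cite: HarrisLanTaylorThorneRMS2016, proof of Thm. 7.13 (p. 232)] -/
theorem finite_setOf_not_exists_goodPrime (π : AutomorphicRepData (AutomorphyDatum.gl n K hcpt))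
    (hcof : π.hasSatakeParamAt_cofinite) (p : ℕ) (hp : p.Prime) :
    {v : HeightOneSpectrum (𝓞 K) | ¬ ∃ q : ℕ, q.Prime ∧ q ≠ p ∧
      Algebra.IsUnramifiedIn (𝓞 K) (Ideal.span {(q : ℤ)}) ∧ π.IsUnramifiedAbove q ∧
      ((q : ℕ) : 𝓞 K) ∈ v.asIdeal}.Finite := by
  classical
  -- finitely many places over a given `q ≠ 0`
  have hover : ∀ {q : ℕ}, q ≠ 0 →
      {v : HeightOneSpectrum (𝓞 K) | ((q : ℕ) : 𝓞 K) ∈ v.asIdeal}.Finite := by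
    intro q hq
    have hne : Ideal.span {((q : ℕ) : 𝓞 K)} ≠ ⊥ := by
      rw [Ne, Ideal.span_singleton_eq_bot]
      exact_mod_cast hq
    convert Ideal.finite_factors hne using 2 with v
    simp [Ideal.dvd_span_singleton]
  -- finitely many primes of `𝓞 K` ramified over `ℤ`
  have hR : {w : HeightOneSpectrum (𝓞 K) | ¬ Algebra.IsUnramifiedAt ℤ w.asIdeal}.Finite := by
    refine (Ideal.finite_factors (differentIdeal_ne_bot (A := ℤ) (B := 𝓞 K))).subset
      fun w hw ↦ ?_
    simp only [Set.mem_setOf_eq] at hw ⊢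
    by_contra hdvd
    exact hw ((not_dvd_differentIdeal_iff (A := ℤ)).mp hdvd)
  choose f hf using fun w : HeightOneSpectrum (𝓞 K) ↦ exists_natPrime_natCast_mem w
  have hB : {w : HeightOneSpectrum (𝓞 K) | ¬ π.IsUnramifiedAt w}.Finite := hcof
  have hSp := hover hp.ne_zero
  have hSR : (⋃ w ∈ {w : HeightOneSpectrum (𝓞 K) | ¬ Algebra.IsUnramifiedAt ℤ w.asIdeal},
      {v : HeightOneSpectrum (𝓞 K) | ((f w : ℕ) : 𝓞 K) ∈ v.asIdeal}).Finite :=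
    hR.biUnion fun w _ ↦ hover (hf w).1.ne_zero
  have hSB : (⋃ w ∈ {w : HeightOneSpectrum (𝓞 K) | ¬ π.IsUnramifiedAt w},
      {v : HeightOneSpectrum (𝓞 K) | ((f w : ℕ) : 𝓞 K) ∈ v.asIdeal}).Finite :=
    hB.biUnion fun w _ ↦ hover (hf w).1.ne_zero
  refine ((hSp.union hSR).union hSB).subset fun v hv ↦ ?_
  by_contra hbad
  simp only [Set.mem_union, Set.mem_setOf_eq, Set.mem_iUnion, exists_prop, not_or,
    not_exists, not_and] at hbad
  obtain ⟨⟨hvp, hvR⟩, hvB⟩ := hbad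
  apply hv
  have hq := hf v
  refine ⟨f v, hq.1, ?_, ?_, ?_, hq.2⟩
  · rintro h
    exact hvp (h ▸ hq.2)
  · intro 𝔓 h𝔓 hover'
    by_contra hwr
    have hq𝔓 : ((f v : ℕ) : 𝓞 K) ∈ 𝔓 := by
      have : (algebraMap ℤ (𝓞 K)) (f v : ℤ) ∈ 𝔓 := by
        rw [← Ideal.mem_comap, ← Ideal.under_def, ← hover'.over]
        exact Ideal.mem_span_singleton_self _
      simpa using this
    have hne : 𝔓 ≠ ⊥ := by
      rintro rfl
      rw [Ideal.mem_bot] at hq𝔓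
      exact hq.1.ne_zero (by exact_mod_cast hq𝔓)
    set w : HeightOneSpectrum (𝓞 K) := ⟨𝔓, h𝔓, hne⟩
    have hfw : f w = f v := natPrime_eq_of_natCast_mem (hf w).1 hq.1 (hf w).2 hq𝔓
    exact hvR w hwr (hfw ▸ hq.2)
  · intro w hw
    by_contra hwr
    have hfw : f w = f v := natPrime_eq_of_natCast_mem (hf w).1 hq.1 (hf w).2 hw
    exact hvB w hwr (hfw ▸ hq.2)

end BadPlaces

/-! ### Thm. 7.13 itself

The theorem is assembled from the above in the sibling file `HarrisLanTaylorThorneThm713Proofs`: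
`theorem713_of_goodPlaces` (the printed argument of p. 232 for an arbitrary finite set `S` of bad
places), `theorem713_of` (Thm. 7.13 with both printed alternatives on `q`, from the named fact
`corollary627_splitOrUnramified`) and `theorem713_unramified_of_splitOrUnramified` (its
specialisation to the branch "`q` unramified in `F`").  The copy of the argument that used to
close this file (`theorem713_unramified_of`, the unramified branch with the set of bad places
hard-wired, deduced from the unramified-only form of Cor. 6.27) was retired on 2026-08-15 as a
duplicate of `theorem713_unramified_of_splitOrUnramified` (identical statement). -/

end HarrisLanTaylorThorne2016
end Lang

end Literature.NumberTheory.Automorphic
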